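import Literature.NumberTheory.Sieve.LinnikLeastPrimeAP
import HarnessLib

/-!
# Linnik–Gallagher in short intervals — the window lemmas

Topic `Literature/NumberTheory/Sieve`. THEOREMS only (no definition, no named fact, no `sorry`).
Lemmas for `LinnikShortIntervals.lean` (statement and context there); this file: the window versions of
the character lemmas of `LinnikLeastPrimeAP.lean` and of Lemma 4.3 per modulus, and two real-variable
facts.
Reproduction of published work: P. X. Gallagher, *A large sieve density estimate near `σ = 1`*,
Invent. Math. 11 (1970), Theorem 7 and its corollary on primes in arithmetic progressions in short
intervals, in Montgomery–Vaughan's form (Acta Arith. 27 (1975), Lemma 4.3 — the tree's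
`MontgomeryVaughan1975.lemma43_gallagher_holds`, with `max_{x ≤ N} max_{h ≤ N}` built in), combined with
Siegel's theorem at exponent `ε` for the exceptional zero: **for every `ε > 0` there are `L, δ, C₀, c > 0`
such that for all `q ≥ 1`, `(a, q) = 1`, all naturals `x ≥ C₀ q^L` and `x^{1−δ} ≤ h ≤ x`,
`∑_{x−h < p ≤ x, p ≡ a (q)} log p ≥ c h/(φ(q) q^ε)`** — in particular such intervals contain primes
`≡ a (mod q)`.  This contains both Linnik's theorem (`LinnikLeastPrimeAP.lean`, `LinnikLowerBound.lean`:
`h = x`) and Hoheisel's theorem (`HoheiselPrimesShortIntervals.lean`: `q = 1`).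

Proof: the window versions of the lemmas of `LinnikLeastPrimeAP.lean` (orthogonality for the class
`a` on `(x − h, x]`, passage to primitive characters at cost `φ(q) log q`, at most one character mod `q`
induced by the exceptional `χ̃`, and then `r̃ ∣ q`); the main term in the exceptional case is
`h − χ̃(a)∑_{x−h<n≤x} n^{β̃−1} ≥ h(1 − (x/2)^{β̃−1}) ≥ h·min(1/2, (1 − β̃) log(x/2)/2)` for `h ≤ x/2`,
with `1 − β̃ ≥ C(ε) q^{−ε}` (Siegel) unless `1 − β̃ ≥ c/log P` (Landau–Page), which is excluded in the
delicate case once `A ≥ 2/c`.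

* `Linnik.norm_sub_charPrimeSum_le_window`, `Linnik.sum_char_inv_mul_sum_eq_window`,
  `Linnik.totient_mul_thetaWindow_ge_exc`, `Linnik.sum_norm_gallagherTerm_le_or_window`,
  `Linnik.min_half_le_one_sub_exp_neg`, `Linnik.sum_Ioc_rpow_le_mul`.

## References

* [Gallagher1970Density] P. X. Gallagher, Invent. Math. 11 (1970) 329–339, Theorem 7.
* [MontgomeryVaughanActa1975] H. L. Montgomery, R. C. Vaughan, Acta Arith. 27 (1975), §4 Lemma 4.3.
* [Linnik1944] Yu. V. Linnik, Mat. Sb. 15 (57) (1944). [Hoheisel1930] G. Hoheisel (1930).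
-/

noncomputable section

open Finset Real

namespace Literature.NumberTheory.Sieve

namespace Linnik

open MontgomeryVaughan1975 PrimesInAPGallagher Literature.NumberTheory.LFunctions

/-! ### Window versions of the character lemmas -/

/-- **Passing to the primitive character costs at most `log q` on any window**: for `χ` mod `q` and
`χ⋆ = χ.primitiveCharacter`, `‖∑_{x−h<p≤x} χ(p) log p − ∑_{x−h<p≤x} χ⋆(p) log p‖ ≤ log q`
(the sums differ only at primes dividing `q`). [folklore] -/
theorem norm_sub_charPrimeSum_le_window {d : ℕ} [NeZero d] (χ : DirichletCharacter ℂ d) (x h : ℕ) :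
    ‖∑ p ∈ (Ioc (x - h) x).filter Nat.Prime, χ (p : ZMod d) * (Real.log p : ℂ) -
        charPrimeSum χ.primitiveCharacter x h‖ ≤ Real.log d := by
  classical
  set S := (Ioc (x - h) x).filter Nat.Prime with hS
  have hcps : charPrimeSum χ.primitiveCharacter x h =
      ∑ p ∈ S, χ.primitiveCharacter (p : ZMod χ.conductor) * (Real.log p : ℂ) := by
    rw [charPrimeSum]
  have h1 : ∑ p ∈ S, χ (p : ZMod d) * (Real.log p : ℂ) =
      ∑ p ∈ S.filter (fun p => p.Coprime d),
        χ.primitiveCharacter (p : ZMod χ.conductor) * (Real.log p : ℂ) := by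
    rw [← Finset.sum_filter_add_sum_filter_not S (fun p => p.Coprime d)]
    have hz : ∑ p ∈ S.filter (fun p => ¬ p.Coprime d), χ (p : ZMod d) * (Real.log p : ℂ) = 0 := by
      refine Finset.sum_eq_zero fun p hp => ?_
      have hnc : ¬ p.Coprime d := (Finset.mem_filter.mp hp).2
      rw [MulChar.map_nonunit χ (mt (ZMod.isUnit_iff_coprime p d).mp hnc), zero_mul]
    rw [hz, add_zero]
    refine Finset.sum_congr rfl fun p hp => ?_
    have hc : p.Coprime d := (Finset.mem_filter.mp hp).2
    congr 1
    have := χ.primitiveCharacter_apply_of_isCoprime (Nat.isCoprime_iff_coprime.mpr hc)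
    push_cast at this
    exact this.symm
  have h2 : charPrimeSum χ.primitiveCharacter x h =
      ∑ p ∈ S.filter (fun p => p.Coprime d),
          χ.primitiveCharacter (p : ZMod χ.conductor) * (Real.log p : ℂ) +
        ∑ p ∈ S.filter (fun p => ¬ p.Coprime d),
          χ.primitiveCharacter (p : ZMod χ.conductor) * (Real.log p : ℂ) := by
    rw [hcps, Finset.sum_filter_add_sum_filter_not]
  rw [h1, h2, sub_add_cancel_left, norm_neg]
  calc ‖∑ p ∈ S.filter (fun p => ¬ p.Coprime d),
          χ.primitiveCharacter (p : ZMod χ.conductor) * (Real.log p : ℂ)‖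
      ≤ ∑ p ∈ S.filter (fun p => ¬ p.Coprime d),
          ‖χ.primitiveCharacter (p : ZMod χ.conductor) * (Real.log p : ℂ)‖ := norm_sum_le _ _
    _ ≤ ∑ p ∈ S.filter (fun p => ¬ p.Coprime d), Real.log p := by
        refine Finset.sum_le_sum fun p hp => ?_
        obtain ⟨hpS, -⟩ := Finset.mem_filter.mp hp
        have hpp : p.Prime := (Finset.mem_filter.mp hpS).2
        have hlog : 0 ≤ Real.log p := Real.log_nonneg (by exact_mod_cast hpp.one_lt.le)
        rw [norm_mul, Complex.norm_real, Real.norm_of_nonneg hlog]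
        exact mul_le_of_le_one_left hlog (DirichletCharacter.norm_le_one _ _)
    _ ≤ ∑ p ∈ d.primeFactors, Real.log p := by
        refine Finset.sum_le_sum_of_subset_of_nonneg (fun p hp => ?_) (fun p hp _ => ?_)
        · obtain ⟨hpS, hnc⟩ := Finset.mem_filter.mp hp
          have hpp : p.Prime := (Finset.mem_filter.mp hpS).2
          have hpd : p ∣ d := by
            by_contra h; exact hnc ((Nat.Prime.coprime_iff_not_dvd hpp).mpr h)
          exact Nat.mem_primeFactors.mpr ⟨hpp, hpd, NeZero.ne d⟩
        · exact Real.log_nonneg (by exact_mod_cast (Nat.prime_of_mem_primeFactors hp).one_lt.le)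
    _ = Real.log (∏ p ∈ d.primeFactors, (p : ℝ)) := by
        rw [Real.log_prod]
        intro p hp
        exact_mod_cast (Nat.prime_of_mem_primeFactors hp).ne_zero
    _ ≤ Real.log d := by
        refine Real.log_le_log (Finset.prod_pos fun p hp => ?_) ?_
        · exact_mod_cast (Nat.prime_of_mem_primeFactors hp).pos
        · have h1 := Nat.le_of_dvd (NeZero.pos d) (Nat.prod_primeFactors_dvd d)
          have h2 : ((∏ p ∈ d.primeFactors, p : ℕ) : ℝ) ≤ d := by exact_mod_cast h1
          rwa [Nat.cast_prod] at h2

/-- **Orthogonality for the class `a` on a window**: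
`∑_χ χ(a⁻¹) ∑_{x−h<p≤x} χ(p) log p = φ(q) · ∑_{x−h<p≤x, p ≡ a (q)} log p`. [folklore] -/
theorem sum_char_inv_mul_sum_eq_window {q : ℕ} [NeZero q] {a : ZMod q} (ha : IsUnit a) (x h : ℕ) :
    ∑ χ : DirichletCharacter ℂ q, χ a⁻¹ * ∑ p ∈ (Ioc (x - h) x).filter Nat.Prime,
        χ (p : ZMod q) * (Real.log p : ℂ) =
      (q.totient : ℂ) * ((∑ p ∈ ((Ioc (x - h) x).filter Nat.Prime).filter
        (fun p : ℕ => (p : ZMod q) = a), Real.log p : ℝ) : ℂ) := by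
  classical
  simp_rw [Finset.mul_sum]
  rw [Finset.sum_comm]
  have : ∀ p ∈ (Ioc (x - h) x).filter Nat.Prime,
      ∑ χ : DirichletCharacter ℂ q, χ a⁻¹ * (χ (p : ZMod q) * (Real.log p : ℂ)) =
        if (p : ZMod q) = a then (q.totient : ℂ) * (Real.log p : ℂ) else 0 := by
    intro p _
    simp_rw [← mul_assoc]
    rw [← Finset.sum_mul, DirichletCharacter.sum_char_inv_mul_char_eq ℂ ha]
    by_cases h : (p : ZMod q) = a
    · rw [if_pos h.symm, if_pos h]
    · rw [if_neg (Ne.symm h), if_neg h, zero_mul]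
  rw [Finset.sum_congr rfl this, ← Finset.sum_filter]
  push_cast
  rw [Finset.mul_sum]

open scoped Classical in
/-- **`φ(q) (θ(x; q, a) − θ(x−h; q, a))` through the characters, with the exceptional correction** on the
window `(x − h, x]` (`h ≤ x`): `φ(q) Θ ≥ h − r' S − ∑_χ ‖∑#̃ χ⋆‖ − φ(q) log q` with
`S = ∑_{x−h<n≤x} n^{β−1}`, `r' = Re ∑_{χ induced by χ̃} χ(a⁻¹)`. [cite: Gallagher1970Density, Theorem 7] -/
theorem totient_mul_thetaWindow_ge_exc {q : ℕ} [NeZero q] {a : ZMod q} (ha : IsUnit a) {x h : ℕ}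
    (hhx : h ≤ x) {r : ℕ} (χe : DirichletCharacter ℂ r) (β : ℝ) :
    (h : ℝ) - (∑ χ ∈ (univ : Finset (DirichletCharacter ℂ q)).filter (fun χ =>
            χ.conductor = r ∧ ∀ n : ℕ, χ.primitiveCharacter (n : ZMod χ.conductor) = χe (n : ZMod r)),
            χ a⁻¹).re * ∑ n ∈ Ioc (x - h) x, (n : ℝ) ^ (β - 1)
        - ∑ χ : DirichletCharacter ℂ q, ‖gallagherTermExc χe β χ.primitiveCharacter x h‖
        - q.totient * Real.log q ≤
      q.totient * ∑ p ∈ ((Ioc (x - h) x).filter Nat.Prime).filter (fun p : ℕ => (p : ZMod q) = a),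
        Real.log p := by
  have hZ := sum_char_inv_mul_sum_eq_window ha x h
  have hw1 : ∀ χ : DirichletCharacter ℂ q, ‖χ a⁻¹‖ ≤ 1 := fun χ => DirichletCharacter.norm_le_one χ _
  -- the decomposition of `∑_{p ≤ N} χ(p) log p`
  have hgt : ∀ χ : DirichletCharacter ℂ q, gallagherTerm χ.primitiveCharacter x h =
      charPrimeSum χ.primitiveCharacter x h - if χ = 1 then (h : ℂ) else 0 := by
    intro χ
    rw [gallagherTerm, Nat.card_Ioc, show x - (x - h) = h by omega]
    congr 1
    by_cases h : χ = 1
    · rw [if_pos h, if_pos (DirichletCharacter.eq_one_iff_conductor_eq_one.mp h)]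
    · rw [if_neg h, if_neg (fun h' => h (DirichletCharacter.eq_one_iff_conductor_eq_one.mpr h'))]
  have hdec : ∀ χ : DirichletCharacter ℂ q,
      χ a⁻¹ * ∑ p ∈ (Ioc (x - h) x).filter Nat.Prime, χ (p : ZMod q) * (Real.log p : ℂ) =
      χ a⁻¹ * gallagherTermExc χe β χ.primitiveCharacter x h
        + χ a⁻¹ * (if χ = 1 then (h : ℂ) else 0)
        - χ a⁻¹ * (if (χ.conductor = r ∧ ∀ n : ℕ,
              χ.primitiveCharacter (n : ZMod χ.conductor) = χe (n : ZMod r))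
            then ((∑ n ∈ Ioc (x - h) x, (n : ℝ) ^ (β - 1) : ℝ) : ℂ) else 0)
        + χ a⁻¹ * (∑ p ∈ (Ioc (x - h) x).filter Nat.Prime, χ (p : ZMod q) * (Real.log p : ℂ) -
            charPrimeSum χ.primitiveCharacter x h) := by
    intro χ
    have h1 : gallagherTermExc χe β χ.primitiveCharacter x h =
        gallagherTerm χ.primitiveCharacter x h + if (χ.conductor = r ∧ ∀ n : ℕ,
              χ.primitiveCharacter (n : ZMod χ.conductor) = χe (n : ZMod r))
            then ((∑ n ∈ Ioc (x - h) x, (n : ℝ) ^ (β - 1) : ℝ) : ℂ) else 0 := by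
      rw [gallagherTermExc]
    rw [h1, hgt χ]
    ring
  have hainv : IsUnit a⁻¹ := by
    obtain ⟨u, hu⟩ := ha
    rw [← hu, ZMod.inv_coe_unit]
    exact Units.isUnit _
  have hone : ∑ χ : DirichletCharacter ℂ q, χ a⁻¹ * (if χ = 1 then (h : ℂ) else 0) = h := by
    rw [Finset.sum_eq_single (1 : DirichletCharacter ℂ q)]
    · rw [if_pos rfl, MulChar.one_apply hainv, one_mul]
    · intro χ _ hχ; rw [if_neg hχ, mul_zero]
    · intro h; exact absurd (Finset.mem_univ _) h
  have hcondsum : ∑ χ : DirichletCharacter ℂ q, χ a⁻¹ * (if (χ.conductor = r ∧ ∀ n : ℕ,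
              χ.primitiveCharacter (n : ZMod χ.conductor) = χe (n : ZMod r))
            then ((∑ n ∈ Ioc (x - h) x, (n : ℝ) ^ (β - 1) : ℝ) : ℂ) else 0) =
      (∑ χ ∈ (univ : Finset (DirichletCharacter ℂ q)).filter (fun χ =>
            χ.conductor = r ∧ ∀ n : ℕ, χ.primitiveCharacter (n : ZMod χ.conductor) = χe (n : ZMod r)),
          χ a⁻¹) * ((∑ n ∈ Ioc (x - h) x, (n : ℝ) ^ (β - 1) : ℝ) : ℂ) := by
    rw [Finset.sum_mul, Finset.sum_filter]
    refine Finset.sum_congr rfl fun χ _ => ?_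
    split_ifs <;> simp
  -- the identity
  have hsum : (q.totient : ℂ) * ((∑ p ∈ ((Ioc (x - h) x).filter Nat.Prime).filter
        (fun p : ℕ => (p : ZMod q) = a), Real.log p : ℝ) : ℂ) =
      ∑ χ : DirichletCharacter ℂ q, χ a⁻¹ * gallagherTermExc χe β χ.primitiveCharacter x h + h
        - (∑ χ ∈ (univ : Finset (DirichletCharacter ℂ q)).filter (fun χ =>
            χ.conductor = r ∧ ∀ n : ℕ, χ.primitiveCharacter (n : ZMod χ.conductor) = χe (n : ZMod r)),
          χ a⁻¹) * ((∑ n ∈ Ioc (x - h) x, (n : ℝ) ^ (β - 1) : ℝ) : ℂ)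
        + ∑ χ : DirichletCharacter ℂ q, χ a⁻¹ *
            (∑ p ∈ (Ioc (x - h) x).filter Nat.Prime, χ (p : ZMod q) * (Real.log p : ℂ) -
              charPrimeSum χ.primitiveCharacter x h) := by
    rw [← hZ, Finset.sum_congr rfl (fun χ _ => hdec χ), Finset.sum_add_distrib,
      Finset.sum_sub_distrib, Finset.sum_add_distrib, hone, hcondsum]
  have hre : (q.totient : ℝ) * (∑ p ∈ ((Ioc (x - h) x).filter Nat.Prime).filter
        (fun p : ℕ => (p : ZMod q) = a), Real.log p : ℝ) =
      (∑ χ : DirichletCharacter ℂ q, χ a⁻¹ * gallagherTermExc χe β χ.primitiveCharacter x h).re + h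
        - (∑ χ ∈ (univ : Finset (DirichletCharacter ℂ q)).filter (fun χ =>
            χ.conductor = r ∧ ∀ n : ℕ, χ.primitiveCharacter (n : ZMod χ.conductor) = χe (n : ZMod r)),
          χ a⁻¹).re * (∑ n ∈ Ioc (x - h) x, (n : ℝ) ^ (β - 1))
        + (∑ χ : DirichletCharacter ℂ q, χ a⁻¹ *
            (∑ p ∈ (Ioc (x - h) x).filter Nat.Prime, χ (p : ZMod q) * (Real.log p : ℂ) -
              charPrimeSum χ.primitiveCharacter x h)).re := by
    have := congrArg Complex.re hsum
    simpa only [Complex.add_re, Complex.sub_re, Complex.natCast_re, Complex.re_mul_ofReal] using this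
  -- bounds
  have hcardq : (Finset.univ : Finset (DirichletCharacter ℂ q)).card = q.totient := by
    rw [Finset.card_univ, ← Nat.card_eq_fintype_card,
      DirichletCharacter.card_eq_totient_of_hasEnoughRootsOfUnity]
  have hb1 : -(∑ χ : DirichletCharacter ℂ q, ‖gallagherTermExc χe β χ.primitiveCharacter x h‖) ≤
      (∑ χ : DirichletCharacter ℂ q, χ a⁻¹ * gallagherTermExc χe β χ.primitiveCharacter x h).re := by
    have h1 := Complex.abs_re_le_norm
      (∑ χ : DirichletCharacter ℂ q, χ a⁻¹ * gallagherTermExc χe β χ.primitiveCharacter x h)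
    have h2 := norm_sum_le (Finset.univ : Finset (DirichletCharacter ℂ q))
      (fun χ => χ a⁻¹ * gallagherTermExc χe β χ.primitiveCharacter x h)
    have h3 : ∑ χ : DirichletCharacter ℂ q, ‖χ a⁻¹ * gallagherTermExc χe β χ.primitiveCharacter x h‖ ≤
        ∑ χ : DirichletCharacter ℂ q, ‖gallagherTermExc χe β χ.primitiveCharacter x h‖ := by
      refine Finset.sum_le_sum fun χ _ => ?_
      rw [norm_mul]
      exact mul_le_of_le_one_left (norm_nonneg _) (hw1 χ)
    have := neg_abs_le (∑ χ : DirichletCharacter ℂ q,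
      χ a⁻¹ * gallagherTermExc χe β χ.primitiveCharacter x h).re
    linarith
  have hb2 : -((q.totient : ℝ) * Real.log q) ≤ (∑ χ : DirichletCharacter ℂ q, χ a⁻¹ *
      (∑ p ∈ (Ioc (x - h) x).filter Nat.Prime, χ (p : ZMod q) * (Real.log p : ℂ) -
        charPrimeSum χ.primitiveCharacter x h)).re := by
    have h1 := Complex.abs_re_le_norm (∑ χ : DirichletCharacter ℂ q, χ a⁻¹ *
      (∑ p ∈ (Ioc (x - h) x).filter Nat.Prime, χ (p : ZMod q) * (Real.log p : ℂ) -
        charPrimeSum χ.primitiveCharacter x h))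
    have h2 := norm_sum_le (Finset.univ : Finset (DirichletCharacter ℂ q)) (fun χ => χ a⁻¹ *
      (∑ p ∈ (Ioc (x - h) x).filter Nat.Prime, χ (p : ZMod q) * (Real.log p : ℂ) -
        charPrimeSum χ.primitiveCharacter x h))
    have h3 : ∑ χ : DirichletCharacter ℂ q, ‖χ a⁻¹ *
        (∑ p ∈ (Ioc (x - h) x).filter Nat.Prime, χ (p : ZMod q) * (Real.log p : ℂ) -
          charPrimeSum χ.primitiveCharacter x h)‖ ≤ q.totient * Real.log q := by
      have := Finset.sum_le_card_nsmul (Finset.univ : Finset (DirichletCharacter ℂ q))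
        (fun χ => ‖χ a⁻¹ * (∑ p ∈ (Ioc (x - h) x).filter Nat.Prime, χ (p : ZMod q) * (Real.log p : ℂ) -
          charPrimeSum χ.primitiveCharacter x h)‖) (Real.log q) (fun χ _ => by
          rw [norm_mul]
          exact (mul_le_of_le_one_left (norm_nonneg _) (hw1 χ)).trans (norm_sub_charPrimeSum_le_window χ x h))
      rwa [hcardq, nsmul_eq_mul] at this
    have := neg_abs_le (∑ χ : DirichletCharacter ℂ q, χ a⁻¹ *
      (∑ p ∈ (Ioc (x - h) x).filter Nat.Prime, χ (p : ZMod q) * (Real.log p : ℂ) -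
        charPrimeSum χ.primitiveCharacter x h)).re
    linarith
  linarith


open scoped Classical in
/-- **Lemma 4.3 per modulus on a window `(x − h, x]`, `x, h ≤ N`**: EITHER no exceptional zero at
level `(c₁, P)` and `∑_{χ mod q} ‖∑# χ⋆‖ ≤ (h + N/P) K e^{−c₃ log N/log P}`, OR an exceptional zero
`(r̃, χ̃, β̃)` occurs and `∑_{χ mod q} ‖∑#̃ χ⋆‖ ≤ (h + N/P) K ((1 − β̃) log P) e^{−c₃ log N/log P}`.
[cite: MontgomeryVaughanActa1975, §4 Lemma 4.3 (4.2)] [cite: Gallagher1970Density, Theorem 7] -/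
theorem sum_norm_gallagherTerm_le_or_window (h43 : lemma43_gallagher) :
    ∃ c₁ : ℝ, 0 < c₁ ∧ ∃ c₃ : ℝ, 0 < c₃ ∧ ∃ c₄ : ℝ, 0 < c₄ ∧ ∃ K : ℝ, 1 ≤ K ∧
      ∀ (N : ℕ) (P : ℝ), 1 ≤ N → Real.exp (Real.sqrt (Real.log N)) ≤ P → P ≤ (N : ℝ) ^ c₄ →
        1 ≤ P → ∀ (x h : ℕ), x ≤ N → h ≤ N → ∀ (q : ℕ) [NeZero q], (q : ℝ) ≤ P →
          ((∀ (r : ℕ) [NeZero r] (χ : DirichletCharacter ℂ r) (β : ℝ), ¬ IsExceptionalZero c₁ P r χ β) ∧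
            ∑ χ : DirichletCharacter ℂ q, ‖gallagherTerm χ.primitiveCharacter x h‖ ≤
              ((h : ℝ) + N / P) * K * Real.exp (-c₃ * Real.log N / Real.log P)) ∨
          ∃ (r : ℕ) (_ : NeZero r) (χe : DirichletCharacter ℂ r) (β : ℝ),
            IsExceptionalZero c₁ P r χe β ∧
            ∑ χ : DirichletCharacter ℂ q, ‖gallagherTermExc χe β χ.primitiveCharacter x h‖ ≤
              ((h : ℝ) + N / P) * K * ((1 - β) * Real.log P) *
                Real.exp (-c₃ * Real.log N / Real.log P) := by
  obtain ⟨c₁, hc₁, c₃, hc₃, c₄, hc₄, C, hC43⟩ := h43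
  refine ⟨c₁, hc₁, c₃, hc₃, c₄, hc₄, max C 1, le_max_right _ _, ?_⟩
  intro N P hN hP1 hP2 hP3 x h hxN hhN q _ hqP
  obtain ⟨hA, hB⟩ := hC43 N P hP1 hP2 (fun _ _ => x) (fun _ _ => h) (fun _ _ => hxN)
    (fun _ _ => hhN)
  set E : ℝ := Real.exp (-c₃ * Real.log N / Real.log P) with hE
  have hE0 : 0 < E := Real.exp_pos _
  have hN0 : (0 : ℝ) < N := by exact_mod_cast hN
  have hNP : 0 < (h : ℝ) + N / P := by positivity
  have hC : C ≤ max C 1 := le_max_left _ _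
  by_cases hex : ∃ (r : ℕ) (_ : NeZero r) (χe : DirichletCharacter ℂ r) (β : ℝ),
      IsExceptionalZero c₁ P r χe β
  · obtain ⟨r, hr, χe, β, hexc⟩ := hex
    refine Or.inr ⟨r, hr, χe, β, hexc, ?_⟩
    have hB' := hB r χe β hexc
    have hemb := sum_conductor_primitiveCharacter_le hqP
      (fun q ψ => ((h : ℝ) + N / P)⁻¹ * ‖gallagherTermExc χe β ψ x h‖)
      (fun q ψ => by positivity) (fun q => inferInstance)
    have hbound : ∑ χ : DirichletCharacter ℂ q,
        ((h : ℝ) + N / P)⁻¹ * ‖gallagherTermExc χe β χ.primitiveCharacter x h‖ ≤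
          C * ((1 - β) * Real.log P) * E := by
      refine hemb.trans ?_
      convert hB' using 2
    have hβ : 0 ≤ (1 - β) * Real.log P := by
      obtain ⟨-, -, -, -, hβ1, -⟩ := hexc
      exact mul_nonneg (by linarith) (Real.log_nonneg hP3)
    have hsum : ∑ χ : DirichletCharacter ℂ q, ‖gallagherTermExc χe β χ.primitiveCharacter x h‖ =
        ((h : ℝ) + N / P) * ∑ χ : DirichletCharacter ℂ q,
          ((h : ℝ) + N / P)⁻¹ * ‖gallagherTermExc χe β χ.primitiveCharacter x h‖ := by
      rw [Finset.mul_sum]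
      refine Finset.sum_congr rfl fun χ _ => ?_
      rw [← mul_assoc, mul_inv_cancel₀ hNP.ne', one_mul]
    rw [hsum]
    calc ((h : ℝ) + N / P) * _ ≤ ((h : ℝ) + N / P) * (C * ((1 - β) * Real.log P) * E) :=
          mul_le_mul_of_nonneg_left hbound hNP.le
      _ ≤ ((h : ℝ) + N / P) * (max C 1 * ((1 - β) * Real.log P) * E) :=
          mul_le_mul_of_nonneg_left
            (mul_le_mul_of_nonneg_right (mul_le_mul_of_nonneg_right hC hβ) hE0.le) hNP.le
      _ = ((h : ℝ) + N / P) * max C 1 * ((1 - β) * Real.log P) * E := by ring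
  · push Not at hex
    have hex' : ∀ (r : ℕ) [NeZero r] (χ : DirichletCharacter ℂ r) (β : ℝ),
        ¬ IsExceptionalZero c₁ P r χ β := fun r _ χ β hx => hex r inferInstance χ β hx
    refine Or.inl ⟨hex', ?_⟩
    have hA' := hA hex'
    have hemb := sum_conductor_primitiveCharacter_le hqP
      (fun q ψ => ((h : ℝ) + N / P)⁻¹ * ‖gallagherTerm ψ x h‖)
      (fun q ψ => by positivity) (fun q => inferInstance)
    have hbound : ∑ χ : DirichletCharacter ℂ q,
        ((h : ℝ) + N / P)⁻¹ * ‖gallagherTerm χ.primitiveCharacter x h‖ ≤ C * E := by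
      refine hemb.trans ?_
      convert hA' using 2
    have hsum : ∑ χ : DirichletCharacter ℂ q, ‖gallagherTerm χ.primitiveCharacter x h‖ =
        ((h : ℝ) + N / P) * ∑ χ : DirichletCharacter ℂ q,
          ((h : ℝ) + N / P)⁻¹ * ‖gallagherTerm χ.primitiveCharacter x h‖ := by
      rw [Finset.mul_sum]
      refine Finset.sum_congr rfl fun χ _ => ?_
      rw [← mul_assoc, mul_inv_cancel₀ hNP.ne', one_mul]
    rw [hsum]
    calc ((h : ℝ) + N / P) * _ ≤ ((h : ℝ) + N / P) * (C * E) :=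
          mul_le_mul_of_nonneg_left hbound hNP.le
      _ ≤ ((h : ℝ) + N / P) * (max C 1 * E) :=
          mul_le_mul_of_nonneg_left (mul_le_mul_of_nonneg_right hC hE0.le) hNP.le
      _ = ((h : ℝ) + N / P) * max C 1 * E := by ring

/-- `1 − e^{−t} ≥ min(1/2, t/2)` for `t ≥ 0` (from `e^{t} ≥ 1 + t`). [folklore] -/
theorem min_half_le_one_sub_exp_neg {t : ℝ} (ht : 0 ≤ t) :
    min (1 / 2) (t / 2) ≤ 1 - Real.exp (-t) := by
  have h1 : Real.exp (-t) * (1 + t) ≤ 1 := by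
    have h2 : 1 + t ≤ Real.exp t := by linarith [Real.add_one_le_exp t]
    have h3 : Real.exp (-t) * Real.exp t = 1 := by rw [← Real.exp_add]; simp
    nlinarith [Real.exp_pos (-t), mul_le_mul_of_nonneg_left h2 (Real.exp_pos (-t)).le]
  have he0 : 0 < Real.exp (-t) := Real.exp_pos _
  -- `e^{-t} ≤ 1/(1+t)`, so `1 − e^{−t} ≥ t/(1+t) ≥ min(1/2, t/2)`
  rcases le_or_gt 1 t with h1t | ht1
  · have : Real.exp (-t) ≤ 1 / 2 := by nlinarith
    exact (min_le_left _ _).trans (by linarith)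
  · have : Real.exp (-t) ≤ 1 - t / 2 := by nlinarith
    exact (min_le_right _ _).trans (by linarith)

/-- The exceptional correction on a window `(x − h, x]` with `2h ≤ x`:
`∑_{x−h<n≤x} n^{β−1} ≤ h · (x/2)^{β−1}` for `β ≤ 1`. [folklore] -/
theorem sum_Ioc_rpow_le_mul {x h : ℕ} (h2 : 2 * (h : ℝ) ≤ x) {β : ℝ} (hβ : β ≤ 1) :
    ∑ n ∈ Ioc (x - h) x, (n : ℝ) ^ (β - 1) ≤ (h : ℝ) * ((x : ℝ) / 2) ^ (β - 1) := by
  have hhx : h ≤ x := by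
    have : (h : ℝ) ≤ x := by linarith [Nat.cast_nonneg (α := ℝ) h]
    exact_mod_cast this
  have hterm : ∀ n ∈ Ioc (x - h) x, (n : ℝ) ^ (β - 1) ≤ ((x : ℝ) / 2) ^ (β - 1) := by
    intro n hn
    rw [Finset.mem_Ioc] at hn
    rcases eq_or_lt_of_le (show (0 : ℝ) ≤ (x : ℝ) / 2 by positivity) with h0 | hpos
    · -- `x = 0`: then `h = 0` and the window is empty — but we have `n` in it; `x ≥ n ≥ 1`
      have : (1 : ℝ) ≤ x := by exact_mod_cast (show 1 ≤ x by omega)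
      linarith
    · have hn1 : (x : ℝ) / 2 ≤ n := by
        have h1 : x - h < n := hn.1
        have h2 : ((x - h : ℕ) : ℝ) = (x : ℝ) - h := by push_cast [Nat.cast_sub hhx]; ring
        have h3 : ((x - h : ℕ) : ℝ) + 1 ≤ n := by exact_mod_cast h1
        linarith
      exact Real.rpow_le_rpow_of_nonpos hpos hn1 (by linarith)
  calc ∑ n ∈ Ioc (x - h) x, (n : ℝ) ^ (β - 1) ≤ ∑ n ∈ Ioc (x - h) x, ((x : ℝ) / 2) ^ (β - 1) :=
        Finset.sum_le_sum hterm
    _ = (h : ℝ) * ((x : ℝ) / 2) ^ (β - 1) := by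
        rw [Finset.sum_const, Nat.card_Ioc, nsmul_eq_mul, show x - (x - h) = h by omega]

end Linnik

end Literature.NumberTheory.Sieve

end
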